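import Summits.Ventures.PercRepro.RankLevelSetHStep

/-!
# PercRepro — C-025 Theorem H, Step 3 and the assembly: `4·#U(4,2) ≤ 3·#{S : ρ(S) = 3}` (p2, gen 5; split gen 6)

Continuation of `RankLevelSetHStep.lean`: the per-line inequality `step_three` (crude bounds `|E ∖ B| ≥ 4`,
`ρ(E ∖ L) + ρ(L ∖ B) ≥ 4`, the binomial inequalities `six_choose_two_le` / `two_choose_two_le`) and
**`four_mul_card_Uf_le`** (Theorem H's combinatorial core on every finite simple matroid).
-/

namespace PercRepro

namespace ThmH

open Finset

variable {α : Type*} [DecidableEq α]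

section StepThree

variable {M : Matroid α} [M.Finite]

omit [DecidableEq α] in
/-- `#{B ⊆ L : |B| = k} = C(|L|, k)`. -/
theorem card_filter_card_eq (L : Finset α) (k : ℕ) :
    (L.powerset.filter (fun B => B.card = k)).card = L.card.choose k := by
  rw [← Finset.powersetCard_eq_filter, Finset.card_powersetCard]

omit [DecidableEq α] in
/-- `a₂(L) = a₃(L) + C(|L|, 2)`. -/
theorem card_ge_two_eq (L : Finset α) :
    (L.powerset.filter (fun B => 2 ≤ B.card)).card =
      (L.powerset.filter (fun B => 3 ≤ B.card)).card + L.card.choose 2 := by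
  have h := Finset.card_filter_add_card_filter_not (s := L.powerset.filter (fun B => 2 ≤ B.card))
    (fun B => 3 ≤ B.card)
  rw [Finset.filter_filter, Finset.filter_filter] at h
  have e1 : L.powerset.filter (fun B => 2 ≤ B.card ∧ 3 ≤ B.card) =
      L.powerset.filter (fun B => 3 ≤ B.card) := by
    apply Finset.filter_congr; intro B _; constructor
    · exact fun h => h.2
    · exact fun h => ⟨by omega, h⟩
  have e2 : L.powerset.filter (fun B => 2 ≤ B.card ∧ ¬ 3 ≤ B.card) =
      L.powerset.filter (fun B => B.card = 2) := by
    apply Finset.filter_congr; intro B _; constructor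
    · exact fun h => by omega
    · exact fun h => ⟨by omega, by omega⟩
  rw [e1, e2, card_filter_card_eq] at h
  exact h.symm

omit [DecidableEq α] in
/-- `a₂(L) + |L| + 1 = 2^{|L|}`. -/
theorem card_ge_two_add (L : Finset α) :
    (L.powerset.filter (fun B => 2 ≤ B.card)).card + L.card + 1 = 2 ^ L.card := by
  have h := Finset.card_filter_add_card_filter_not (s := L.powerset) (fun B => 2 ≤ B.card)
  rw [Finset.card_powerset] at h
  have h2 := Finset.card_filter_add_card_filter_not (s := L.powerset.filter (fun B => ¬ 2 ≤ B.card))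
    (fun B => B.card = 1)
  rw [Finset.filter_filter, Finset.filter_filter] at h2
  have e1 : L.powerset.filter (fun B => ¬ 2 ≤ B.card ∧ B.card = 1) =
      L.powerset.filter (fun B => B.card = 1) := by
    apply Finset.filter_congr; intro B _; constructor
    · exact fun h => h.2
    · exact fun h => ⟨by omega, h⟩
  have e2 : L.powerset.filter (fun B => ¬ 2 ≤ B.card ∧ ¬ B.card = 1) =
      L.powerset.filter (fun B => B.card = 0) := by
    apply Finset.filter_congr; intro B _; constructor
    · exact fun h => by omega
    · exact fun h => ⟨by omega, by omega⟩
  rw [e1, e2, card_filter_card_eq, card_filter_card_eq, Nat.choose_one_right,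
    Nat.choose_zero_right] at h2
  omega

omit [DecidableEq α] in
/-- A line has at least two points. -/
theorem two_le_card_of_mem_lines {L : Finset α} (hL : L ∈ lines M) : 2 ≤ L.card := by
  have h := M.eRk_le_encard (L : Set α)
  rw [(mem_lines.1 hL).2.2, Set.encard_coe_eq_coe_finsetCard] at h
  exact_mod_cast h

/-- For `B ∈ U_L`: `4 + |B| ≤ |E ∖ L| + |L|` (rank `4` needs four points in `E ∖ B`). -/
theorem four_add_card_le {L B : Finset α} (hL : L ∈ lines M) (hB : B ∈ UL M L) :
    4 + B.card ≤ (gr M \ L).card + L.card := by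
  simp only [UL, Finset.mem_filter, Finset.mem_powerset] at hB
  obtain ⟨hBL, -, hr⟩ := hB
  have hLE := (mem_lines.1 hL).1
  have h := M.eRk_le_encard ((gr M \ B : Finset α) : Set α)
  rw [hr, Set.encard_coe_eq_coe_finsetCard] at h
  have h' : 4 ≤ (gr M \ B).card := by exact_mod_cast h
  rw [Finset.card_sdiff_of_subset (hBL.trans hLE)] at h'
  rw [Finset.card_sdiff_of_subset hLE]
  have := Finset.card_le_card hBL
  have := Finset.card_le_card hLE
  omega

/-- For `B ∈ U_L`: `2 ≤ |E ∖ L|` (submodularity: `ρ(E ∖ B) ≤ ρ(E ∖ L) + ρ(L ∖ B) ≤ |E ∖ L| + 2`). -/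
theorem two_le_card_sdiff {L B : Finset α} (hL : L ∈ lines M) (hB : B ∈ UL M L) :
    2 ≤ (gr M \ L).card := by
  simp only [UL, Finset.mem_filter, Finset.mem_powerset] at hB
  obtain ⟨hBL, -, hr⟩ := hB
  have hLE := (mem_lines.1 hL).1
  have hsplit : gr M \ B = (gr M \ L) ∪ (L \ B) := (Finset.sdiff_union_sdiff_cancel hLE hBL).symm
  have h1 := M.eRk_union_le_eRk_add_eRk ((gr M \ L : Finset α) : Set α) ((L \ B : Finset α) : Set α)
  rw [← Finset.coe_union, ← hsplit, hr] at h1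
  have h2 : M.eRk ((gr M \ L : Finset α) : Set α) ≤ ((gr M \ L).card : ℕ∞) := by
    have := M.eRk_le_encard ((gr M \ L : Finset α) : Set α)
    rwa [Set.encard_coe_eq_coe_finsetCard] at this
  have h3 : M.eRk ((L \ B : Finset α) : Set α) ≤ 2 := by
    rw [← (mem_lines.1 hL).2.2]
    exact M.eRk_mono (by exact_mod_cast (Finset.sdiff_subset : L \ B ⊆ L))
  have h4 : (4 : ℕ∞) ≤ ((gr M \ L).card : ℕ∞) + 2 := h1.trans (add_le_add h2 h3)
  have h5 : (4 : ℕ∞) ≤ (((gr M \ L).card + 2 : ℕ) : ℕ∞) := by push_cast; exact h4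
  have h6 : 4 ≤ (gr M \ L).card + 2 := by exact_mod_cast h5
  omega

/-- `U_L ⊆ {B ⊆ L : 2 ≤ |B|}`. -/
theorem UL_subset (L : Finset α) : UL M L ⊆ L.powerset.filter (fun B => 2 ≤ B.card) := by
  intro B hB
  simp only [UL, Finset.mem_filter, Finset.mem_powerset] at hB ⊢
  exact ⟨hB.1, hB.2.1⟩

/-- `#U_L ≤ a₂(L)`. -/
theorem card_UL_le (L : Finset α) : (UL M L).card ≤ (L.powerset.filter (fun B => 2 ≤ B.card)).card :=
  Finset.card_le_card (UL_subset L)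

/-- When `|E ∖ L| ≤ 3`, `L ∉ U_L`, so `#U_L + 1 ≤ a₂(L)`. -/
theorem card_UL_add_one_le {L : Finset α} (hL : L ∈ lines M) (hn : (gr M \ L).card ≤ 3) :
    (UL M L).card + 1 ≤ (L.powerset.filter (fun B => 2 ≤ B.card)).card := by
  have hLmem : L ∈ L.powerset.filter (fun B => 2 ≤ B.card) := by
    simp only [Finset.mem_filter, Finset.mem_powerset]
    exact ⟨subset_refl _, two_le_card_of_mem_lines hL⟩
  have hsub : UL M L ⊆ (L.powerset.filter (fun B => 2 ≤ B.card)).erase L := by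
    intro B hB
    rw [Finset.mem_erase]
    refine ⟨?_, UL_subset L hB⟩
    rintro rfl
    have := four_add_card_le hL hB
    omega
  have := Finset.card_le_card hsub
  rw [Finset.card_erase_of_mem hLmem] at this
  have hpos : 1 ≤ (L.powerset.filter (fun B => 2 ≤ B.card)).card := Finset.card_pos.2 ⟨L, hLmem⟩
  omega

/-- When `|E ∖ L| ≤ 2` and `|L| ≥ 3`, `U_L` avoids `L` and the `|L|` sets `L ∖ {pt}`: `#U_L + |L| + 1 ≤ a₂(L)`. -/
theorem card_UL_add_card_le {L : Finset α} (hL : L ∈ lines M) (hn : (gr M \ L).card ≤ 2)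
    (hℓ : 3 ≤ L.card) :
    (UL M L).card + L.card + 1 ≤ (L.powerset.filter (fun B => 2 ≤ B.card)).card := by
  set X : Finset (Finset α) := L.powerset.filter (fun B => L.card - 1 ≤ B.card) with hX
  have hXsub : X ⊆ L.powerset.filter (fun B => 2 ≤ B.card) := by
    intro B hB
    simp only [hX, Finset.mem_filter, Finset.mem_powerset] at hB ⊢
    exact ⟨hB.1, by omega⟩
  have hXcard : X.card = L.card + 1 := by
    have h := Finset.card_filter_add_card_filter_not (s := X) (fun B => B.card = L.card)
    rw [hX, Finset.filter_filter, Finset.filter_filter] at h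
    have e1 : L.powerset.filter (fun B => L.card - 1 ≤ B.card ∧ B.card = L.card) =
        L.powerset.filter (fun B => B.card = L.card) := by
      apply Finset.filter_congr; intro B _; constructor
      · exact fun h => h.2
      · exact fun h => ⟨by omega, h⟩
    have e2 : L.powerset.filter (fun B => L.card - 1 ≤ B.card ∧ ¬ B.card = L.card) =
        L.powerset.filter (fun B => B.card = L.card - 1) := by
      apply Finset.filter_congr; intro B hB
      rw [Finset.mem_powerset] at hB
      have := Finset.card_le_card hB
      constructor
      · exact fun h => by omega
      · exact fun h => ⟨by omega, by omega⟩
    rw [e1, e2, card_filter_card_eq, card_filter_card_eq, Nat.choose_self] at h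
    obtain ⟨m, hm⟩ : ∃ m, L.card = m + 1 := ⟨L.card - 1, by omega⟩
    rw [hm, Nat.add_sub_cancel, Nat.choose_succ_self_right] at h
    rw [hX, hm, Nat.add_sub_cancel]
    omega
  have hsub : UL M L ⊆ (L.powerset.filter (fun B => 2 ≤ B.card)) \ X := by
    intro B hB
    rw [Finset.mem_sdiff]
    refine ⟨UL_subset L hB, ?_⟩
    intro hBX
    simp only [hX, Finset.mem_filter, Finset.mem_powerset] at hBX
    have := four_add_card_le hL hB
    omega
  have := Finset.card_le_card hsub
  rw [Finset.card_sdiff_of_subset hXsub, hXcard] at this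
  have := Finset.card_le_card hXsub
  omega

/-- **Step 3 (per line)**: `4·#U_L ≤ (3·a₃(L) + C(|L|, 2))·|E ∖ L|`. -/
theorem step_three {L : Finset α} (hL : L ∈ lines M) :
    4 * (UL M L).card ≤
      (3 * (L.powerset.filter (fun B => 3 ≤ B.card)).card + L.card.choose 2) * (gr M \ L).card := by
  set n' := (gr M \ L).card with hn'
  set a₂ := (L.powerset.filter (fun B => 2 ≤ B.card)).card with ha₂
  set a₃ := (L.powerset.filter (fun B => 3 ≤ B.card)).card with ha₃
  set u := (UL M L).card with hu
  have h1 : a₂ = a₃ + L.card.choose 2 := card_ge_two_eq L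
  have h2 : a₂ + L.card + 1 = 2 ^ L.card := card_ge_two_add L
  have hℓ := two_le_card_of_mem_lines hL
  have hu₂ : u ≤ a₂ := card_UL_le L
  rcases Nat.lt_or_ge n' 2 with hlt | hge
  · -- no member of U_L at all
    have : u = 0 := by
      rw [hu, Finset.card_eq_zero, Finset.eq_empty_iff_forall_notMem]
      intro B hB
      have := two_le_card_sdiff hL hB
      omega
    rw [this]; exact Nat.zero_le _
  rcases Nat.lt_or_ge n' 4 with hlt4 | hge4
  · rcases Nat.eq_or_lt_of_le hge with h2' | h3'
    · -- n' = 2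
      rw [← h2']
      rcases Nat.eq_or_lt_of_le hℓ with hℓ2 | hℓ3
      · -- |L| = 2: U_L is empty
        have : u = 0 := by
          rw [hu, Finset.card_eq_zero, Finset.eq_empty_iff_forall_notMem]
          intro B hB
          have := four_add_card_le hL hB
          have : 2 ≤ B.card := (Finset.mem_filter.1 hB).2.1
          omega
        rw [this]; exact Nat.zero_le _
      · have hb := card_UL_add_card_le hL (by omega) hℓ3
        have := two_choose_two_le L.card
        nlinarith
    · -- n' = 3
      have hn3 : n' = 3 := by omega
      rw [hn3]
      have hb := card_UL_add_one_le hL (by omega)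
      have := six_choose_two_le L.card
      nlinarith
  · -- n' ≥ 4
    nlinarith

end StepThree

section Assembly

variable {M : Matroid α} [M.Finite]

/-- **Theorem H, combinatorial core**: on a finite simple matroid, `4·#U(4,2) ≤ 3·#{S : ρ(S) = 3}`. -/
theorem four_mul_card_Uf_le (hs : Simple M) : 4 * (Uf M).card ≤ 3 * (Yall M).card := by
  calc 4 * (Uf M).card ≤ 4 * ∑ L ∈ lines M, (UL M L).card := Nat.mul_le_mul_left _ (step_two M)
    _ = ∑ L ∈ lines M, 4 * (UL M L).card := Finset.mul_sum _ _ _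
    _ ≤ ∑ L ∈ lines M, (3 * (L.powerset.filter (fun B => 3 ≤ B.card)).card + L.card.choose 2) *
          (gr M \ L).card := Finset.sum_le_sum (fun L hL => step_three hL)
    _ ≤ 3 * (Yall M).card := step_one hs

end Assembly

end ThmH

end PercRepro
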